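import Literature.MathematicalPhysics.QuantumFieldTheory.Balaban1983to89.Node00.Record13
import Literature.MathematicalPhysics.QuantumFieldTheory.Balaban1983to89.Node00.Record12DatumKey

/-!
# NODE 00 (YM-PLAN Track A) — THE DATUM ∕ RECORD KEYS AT STAGE 13: «`D` is a datum of record, Stage 13» (`IsDatumOfRecord₁₃C`), ITS CANONICAL PARAMETER
# (`IsDatumOfRecord₁₃C.params ∕ .provisos`, by choice), the canonicalised readings (`canon₁₃`), the θ-exposed record key and the residual assignments of the rate-record
# home (`IsRateKey₁₃`, `RateAssignment₁₃`, `SpineAssignment₁₃`), the keys RESTRICTED TO A REGIME (`IsDatumOfRecord₁₃COn`, `IsRecordOfRecord₁₃COn`, `canon₁₃On`) and the instances at THE GUARD OF RECORD «print's partition of unity ∧ non-degenerate present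
# slots» (`unityNondeg₁₃`; `IsDatumOfRecord₁₃CN`, `IsRecordOfRecord₁₃CN` — the «CN key»)

NODE 00 RECORD MODULE (cell `pub-ymgap`, seat `pub-ymgap-node00-def-RR-2` gen 5 = second reader ∕ key + instance side of the RATE-RECORD HOME, director-ym R141 (A);
dag-lead DEDUP-165 ∕ WORDS-110 ∕ WORDS-112: «the datum key at every record stage is RR-2's object»).  THE STAGE-13 RE-KEY, in ONE module, of this seat's two Stage-12 key
modules `Node00/Record12DatumKey` (§1–§3: C key, `canon₁₂`, `IsRateKey₁₂`) and `Node00/Record12DatumKeyCN` (§1–§4: regime keys, `canon₁₂On`, guard of record, CN key),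
over seat def-T's `Node00/Record13` (director-ym LINES №125 «RECORD 13» ∕ №128: the Stage-12 record RE-BASED on the canonical-version transport of record and the
(2.9)-species small-field function, the displayed provisos `Stage13Params.Provisos₁₃` re-read along the Stage-13 histories with the located over-reaching fields of
`Provisos₁₂` re-pointed and NO transport field; PARAMETERS `Stage13Params extends Stage12Params` by ONE numeric letter `ε₂₉` (the (2.9)-species small-field width), every Stage-12 letter ∕ predicate reached
through `toStage12Params`).  Every name below is the Stage-12 name with `12 ↦ 13`, typed over `θ : Stage13Params F N`.  APPEND-ONLY: a NEW module importing
`Node00/Record13` and this seat's `Node00/Record12DatumKey` (for RR-1's stage-free object containers `RateObjects₁₁` ∕ `SpineObjects₁₁` of `Node00/RateRecord11` and the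
Stage-12 assignment types the lifts read); nothing landed is edited; everything it reads (`Stage13Params.Provisos₁₃ ∕ .Admissible ∕ .SlotsNondegenerate₁₃ ∕ .toStage5₁₃`,
`Stage12Params.ZtUnity` through the parent projection, `datumOfRecord₁₃`, `IsRecordOfRecord₁₃C`, `exists_world_isRecordOfRecord₁₃C`, `exists_provisos_of_isRecordOfRecord₁₃C`,
`exists_isRecordOfRecord₅C_of_isRecordOfRecord₁₃C`, the `rfl` faces `βfun_ ∕ flow_g_ ∕ av_ ∕ isDatumOfRecord₀_datumOfRecord₁₃`, `isPrintedAveraged_datumOfRecord₁₃`) is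
CONSUMED BY NAME.

WHY THIS OBJECT (unchanged from Stages 11 ∕ 12).  The two carrier records of clusters K4 ∕ K5 — the rate-record home (T-RATE) `YMDAG.UVSplit.RRec₁₂(On)` and the
spine-record home (T-SPINE) `YMDAG.UVSplit.SRec₁₂(On)` — are read JOINTLY by the N19′ edge (`…N27AtRecordK4.spine_of_rateStubs_coreEdge`), so both must be keyed to ONE
parameter per datum: THE CANONICAL STAGE-13 PARAMETER `h.params := Classical.choose h` of `h : IsDatumOfRecord₁₃C F N D`, with `h.provisos : h.params.Provisos₁₃ F N`,
`h.admissible`, `h.eq_datumOfRecord₁₃ : D = datumOfRecord₁₃ F N h.params h.provisos`.  Every θ-level object of record `X θ hP g₀ os` then has ONE datum-level INSTANCE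
`X h.params h.provisos g₀ os` per `(F, D, g₀, os)`; records keyed «`∃ θ hP, θ.Admissible F N ∧ D = datumOfRecord₁₃ F N θ hP ∧ S = canon₁₃ F N cr θ hP g₀ os`» are COHERENT
(`exists_keyed_canon₁₃_iff`, `keyed_canon₁₃_coherent`); a consumer proving its node AT EVERY admissible Stage-13 tuple with provisos proves it at the instance
(`IsDatumOfRecord₁₃C.forall_params`).  `isDatumOfRecord₁₃C_iff_exists_world`: the datum class IS def-T's `IsRecordOfRecord₁₃C` with the world forgotten, so «`∃ D w,
IsRecordOfRecord₁₃C F N D w`» reads the same either way (`exists_isDatumOfRecord₁₃C_iff_exists_record`) and REDUCES HONESTLY to «one admissible Stage-13 tuple with every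
proviso field a theorem» (`exists_isDatumOfRecord₁₃C_iff_exists_params`) — INHABITATION IS NOT CLAIMED HERE.  `IsRateKey₁₃ F N D w θ` is `IsRecordOfRecord₁₃C`'s body with
θ EXPOSED (`isRecordOfRecord₁₃C_iff_exists_isRateKey₁₃`, `Iff.rfl`) — the key the rate-record home's layer B quantifies over.  THE REGIME KEYS (§4–§6): the C key carries
`Provisos₁₃ ∧ Admissible` ONLY, and a guard on `θ` does NOT reach the C-canonical parameter of `θ`'s datum (two tuples with one datum are not excluded; no `params = θ`
lemma exists or can), so a reading that genuinely CONSUMES a regime `Rg : (F : T4Family) → Stage13Params F N → Prop` (print's partition of unity, non-degenerate slots, …)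
quantifies over `IsDatumOfRecord₁₃COn F N Rg D` ∕ `IsRecordOfRecord₁₃COn F N Rg D w` (the common prefix «`∃ θ hP, Rg F θ ∧ θ.Admissible F N ∧ D = datumOfRecord₁₃ F N θ hP`»
of the regime homes' keys; canonical parameter IN the regime, `h.regime : Rg F h.params`; junction `forall_isRecordOfRecord₁₃COn_iff` = the shape a guarded item composer
reads the item's text off; `canon₁₃On Rg` with COHERENCE).  §7 names THE GUARD OF RECORD at Stage 13, `unityNondeg₁₃ N F θ := θ.ZtUnity F N ∧ θ.SlotsNondegenerate₁₃ F N`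
(director-ym LINE №125 (3): the rev-15 guard conjunction carried; `ZtUnity` is FILE 12b's `Stage12Params.ZtUnity` at `θ.toStage12Params`, non-degeneracy is read
along the Stage-13 histories by def-T's `Stage13Params.SlotsNondegenerate₁₃`, `F N` explicit), and instantiates the CN key with the literal faces `isDatumOfRecord₁₃CN_iff`, `exists_isDatumOfRecord₁₃CN_iff_exists_params` (= the body «`∃ θ, θ.Provisos₁₃ F N ∧
(θ.ZtUnity F N ∧ θ.SlotsNondegenerate₁₃ F N) ∧ θ.Admissible F N`» a Stage-13 re-key of K0′ would read at `(F, N)`) and `forall_isRecordOfRecord₁₃CN_iff` (= the guarded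
∀-items' binder prefix).  At the trivial regime everything is the C key again (`isDatumOfRecord₁₃COn_true_iff`, `isRecordOfRecord₁₃COn_true_iff`).

WHAT IS NOT HERE.  NO `₁₂ ↔ ₁₃` key bridge (def-T: the histories of record differ — `betaOfRecord₁₀` vs `betaOfRecord₁₃` — so neither `Provisos₁₂ → Provisos₁₃` nor the
converse is a lemma; the Stage-12 keys and their consumers stand as they are).  NO transport-regularity face: `Provisos₁₃` displays NO continuous-version-transport field
(dag-lead WORDS-120 D2; the canonical version is K0e's object, read by name by the β-side consumers), so `IsDatumOfRecord₁₂C.hasContTransportAlong` has no Stage-13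
analogue.  NO inhabitant of any key.

HONEST FRAMING.  Definitions of record + kernel bookkeeping (`Classical.choose`, `rfl`, `dite`, ∃-repackaging); NOTHING of Bałaban's is asserted; NO inhabitant of any key
is claimed (the record's inhabitation item is OPEN); no node is discharged; counts unmoved; one finite four-torus programme at fixed `ε` — NOT the continuum limit on ℝ⁴, NOT
infinite volume, NOT OS, NOT a mass gap, NOT the Clay problem.  No `sorry` ∕ `axiom` ∕ `opaque` ∕ `instance` ∕ `notation`.  [Balaban1989LargeFieldII] = Commun. Math. Phys.
**122** (1989) 355–392; [Balaban1988Convergent] = Commun. Math. Phys. **119** (1988) 243–285; [Balaban1987RG1] = Commun. Math. Phys. **109** (1987) 249–301;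
[Balaban1989LargeFieldI] = Commun. Math. Phys. **122** (1989) 175–202.
-/

noncomputable section

namespace Literature.MathematicalPhysics.QuantumFieldTheory.Balaban1983to89.Node00

open T4Continuum AveragingRT T4FiniteEpsInhabited FlowStep FlowStepRuns DagBinding T4DatumAssembly

/-! ## §1. «`D` is a datum of record, Stage 13» and its CANONICAL parameter -/

section DatumKey

variable (F : T4Family) (N : ℕ) [NeZero N]

/-- **«`D` is a datum of record, Stage 13 (C-class)»**: SOME admissible Stage-13 parameter tuple satisfying its displayed provisos has `D` as its datum of record — the
datum-level shadow of `IsRecordOfRecord₁₃C` (the world forgotten; `isDatumOfRecord₁₃C_iff_exists_world`). [cite: Balaban1989LargeFieldII, Thm 1 + (0.1) pp.355–356; Balaban1988Convergent, Thms 1–2 pp.262–263 (objects of record; bookkeeping)] -/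
def IsDatumOfRecord₁₃C (D : FiniteEpsData F (SU N)) : Prop :=
  ∃ (θ : Stage13Params F N) (h : θ.Provisos₁₃ F N), θ.Admissible F N ∧ D = datumOfRecord₁₃ F N θ h

/-- Every admissible Stage-13 parameter tuple with provisos yields a datum of record. [cite: Balaban1989LargeFieldII, Thm 1 + (0.1) pp.355–356 (bookkeeping)] -/
theorem isDatumOfRecord₁₃C_datumOfRecord₁₃ (θ : Stage13Params F N) (h : θ.Provisos₁₃ F N) (hθ : θ.Admissible F N) :
    IsDatumOfRecord₁₃C F N (datumOfRecord₁₃ F N θ h) :=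
  ⟨θ, h, hθ, rfl⟩

/-- **K0′ READS THE SAME AT THE DATUM**: some datum of record exists at `(F, N)` iff some Stage-13 record pair `(D, w)` exists (the body of the route's K0′
`Record12Inhabited` at `N`). [cite: Balaban1989LargeFieldII, Thm 1 + (0.1) pp.355–356 (bookkeeping)] -/
theorem exists_isDatumOfRecord₁₃C_iff_exists_record :
    (∃ D : FiniteEpsData F (SU N), IsDatumOfRecord₁₃C F N D) ↔ ∃ (D : FiniteEpsData F (SU N)) (w : WorldP), IsRecordOfRecord₁₃C F N D w := by
  constructor
  · rintro ⟨_, θ, hP, hθ, rfl⟩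
    obtain ⟨w, hw, -⟩ := exists_world_isRecordOfRecord₁₃C F N θ hP hθ ⟨hθ.toStage9.gamma_pos, le_rfl⟩
    exact ⟨_, w, hw⟩
  · rintro ⟨D, w, hw⟩
    exact ⟨D, exists_provisos_of_isRecordOfRecord₁₃C hw⟩

/-- **THE HONEST REDUCTION OF K0′**: some datum of record exists at `(F, N)` iff SOME Stage-13 parameter tuple is admissible and satisfies every displayed proviso —
«exhibit ONE admissible `Stage13Params` with EVERY proviso field a theorem» (the K0′ components); inhabitation is NOT claimed in this module.
[cite: Balaban1988Convergent, (2.7) p.255, (2.21) p.258, (2.28) p.259, (3.16) p.268, (3.21) p.269; Balaban1987RG1, (1.12)–(1.15) p.262 (hypothesis dictionary; bookkeeping)] -/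
theorem exists_isDatumOfRecord₁₃C_iff_exists_params :
    (∃ D : FiniteEpsData F (SU N), IsDatumOfRecord₁₃C F N D) ↔ ∃ θ : Stage13Params F N, θ.Provisos₁₃ F N ∧ θ.Admissible F N := by
  constructor
  · rintro ⟨_, θ, hP, hθ, -⟩
    exact ⟨θ, hP, hθ⟩
  · rintro ⟨θ, hP, hθ⟩
    exact ⟨_, isDatumOfRecord₁₃C_datumOfRecord₁₃ F N θ hP hθ⟩

variable {F N}
variable {D : FiniteEpsData F (SU N)} {w : WorldP}

/-- A Stage-13 record's datum is a Stage-13 datum of record. [cite: Balaban1989LargeFieldII, Thm 1 p.355 (bookkeeping)] -/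
theorem isDatumOfRecord₁₃C_of_isRecordOfRecord₁₃C (h : IsRecordOfRecord₁₃C F N D w) : IsDatumOfRecord₁₃C F N D :=
  exists_provisos_of_isRecordOfRecord₁₃C h

/-- **DATUM OF RECORD ⟺ RECORD AT SOME WORLD.** [cite: Balaban1989LargeFieldII, Thm 1 + (0.1) pp.355–356 (bookkeeping)] -/
theorem isDatumOfRecord₁₃C_iff_exists_world : IsDatumOfRecord₁₃C F N D ↔ ∃ w : WorldP, IsRecordOfRecord₁₃C F N D w := by
  constructor
  · rintro ⟨θ, hP, hθ, rfl⟩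
    obtain ⟨w, hw, -⟩ := exists_world_isRecordOfRecord₁₃C F N θ hP hθ ⟨hθ.toStage9.gamma_pos, le_rfl⟩
    exact ⟨w, hw⟩
  · rintro ⟨w, hw⟩
    exact isDatumOfRecord₁₃C_of_isRecordOfRecord₁₃C hw

/-- **THE CANONICAL STAGE-13 PARAMETER OF A DATUM OF RECORD** (choice) — the ONE key both carrier records of clusters K4 ∕ K5 are read at.
[cite: Balaban1989LargeFieldII, Thm 1 + (0.1) pp.355–356 (bookkeeping)] -/
def IsDatumOfRecord₁₃C.params (h : IsDatumOfRecord₁₃C F N D) : Stage13Params F N :=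
  Classical.choose h

/-- Its provisos. [cite: Balaban1988Convergent, (2.7) p.255, (2.21) p.258, (2.35) p.261 (bookkeeping)] -/
theorem IsDatumOfRecord₁₃C.provisos (h : IsDatumOfRecord₁₃C F N D) : h.params.Provisos₁₃ F N :=
  (Classical.choose_spec h).fst

/-- Its admissibility. [cite: Balaban1987RG1, (1.12) p.262; Balaban1988Convergent, (2.10) p.256 (bookkeeping)] -/
theorem IsDatumOfRecord₁₃C.admissible (h : IsDatumOfRecord₁₃C F N D) : h.params.Admissible F N :=
  (Classical.choose_spec h).snd.1

/-- **The datum IS the datum of record of its canonical parameter.** [cite: Balaban1989LargeFieldII, Thm 1 p.355 (bookkeeping)] -/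
theorem IsDatumOfRecord₁₃C.eq_datumOfRecord₁₃ (h : IsDatumOfRecord₁₃C F N D) : D = datumOfRecord₁₃ F N h.params h.provisos :=
  (Classical.choose_spec h).snd.2

/-- The canonical parameter's coupling window is positive. [cite: Balaban1987RG1, (0.21) p.256 (bookkeeping)] -/
theorem IsDatumOfRecord₁₃C.gamma_pos (h : IsDatumOfRecord₁₃C F N D) : 0 < h.params.γ :=
  h.admissible.toStage9.gamma_pos

/-- … and lies inside `]0, 1[` (the Stage-12 sign `γ < 1` of the tuple's Stage-12 admissibility). [cite: Balaban1988Convergent, (2.28) p.259 (bookkeeping)] -/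
theorem IsDatumOfRecord₁₃C.gamma_lt_one (h : IsDatumOfRecord₁₃C F N D) : h.params.γ < 1 :=
  h.admissible.toStage12.pos₁₂.2.2.2.2

/-- **WHAT A CONSUMER PROVES ⟹ WHAT THE INSTANCE CARRIES**: a property of the objects of record established at EVERY admissible Stage-13 parameter tuple with provisos
holds at the canonical parameter of every datum of record. [cite: Balaban1989LargeFieldII, Thm 1 p.355 (bookkeeping)] -/
theorem IsDatumOfRecord₁₃C.forall_params {P : (D : FiniteEpsData F (SU N)) → (θ : Stage13Params F N) → θ.Provisos₁₃ F N → Prop}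
    (hP : ∀ (θ : Stage13Params F N) (hθ : θ.Provisos₁₃ F N), θ.Admissible F N → P (datumOfRecord₁₃ F N θ hθ) θ hθ) (h : IsDatumOfRecord₁₃C F N D) :
    P D h.params h.provisos := by
  have := hP h.params h.provisos h.admissible
  rwa [← h.eq_datumOfRecord₁₃] at this

/-- **WORLD COMPANION IN `₁₃C` AT ANY WINDOW BELOW THE CANONICAL ONE**: for `0 < γw ≤ h.params.γ` some world makes `(D, w)` a Stage-13 record with `w.γ = γw` — what
the N17 home-keying binder («`RRec … R → ∃ w, IsRecordOfRecord₁₃C F N D w ∧ R.u3.γ = w.γ`») consumes once `R.u3.γ` is pinned in that range.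
[cite: Balaban1989LargeFieldII, Thm 1 + (0.1) pp.355–356 (bookkeeping)] -/
theorem IsDatumOfRecord₁₃C.exists_world (h : IsDatumOfRecord₁₃C F N D) {γw : ℝ} (hγw : 0 < γw ∧ γw ≤ h.params.γ) :
    ∃ w : WorldP, IsRecordOfRecord₁₃C F N D w ∧ w.γ = γw := by
  obtain ⟨w, hw, hγ⟩ := exists_world_isRecordOfRecord₁₃C F N h.params h.provisos h.admissible hγw
  exact ⟨w, h.eq_datumOfRecord₁₃ ▸ hw, hγ⟩

/-- … in particular at the canonical window `h.params.γ` itself. [cite: Balaban1989LargeFieldII, Thm 1 + (0.1) pp.355–356 (bookkeeping)] -/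
theorem IsDatumOfRecord₁₃C.exists_world_gamma (h : IsDatumOfRecord₁₃C F N D) :
    ∃ w : WorldP, IsRecordOfRecord₁₃C F N D w ∧ w.γ = h.params.γ :=
  h.exists_world ⟨h.gamma_pos, le_rfl⟩

/-- **THE DATUM's β-FUNCTIONS ARE THE STAGE-13 β OF RECORD AT THE CANONICAL PARAMETER** (def-T's `βfun_datumOfRecord₁₃`, `rfl` there; `betaOfRecord₁₃ F N θ` over
`Stage13Params` is def-T's reducible name for the β of record re-based on the canonical-version transport and the (2.9)-species small-field function — NOT `betaOfRecord₁₀` of Stages 10–12: the histories of record differ, and there is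
NO ₁₂ ↔ ₁₃ key bridge in this module) — what the (D4) read-out binders and node N17 read off `D`.
[cite: Balaban1987RG1, (1.20)–(1.22) p.264 (bookkeeping)] -/
theorem IsDatumOfRecord₁₃C.βfun_eq_betaOfRecord₁₃ (h : IsDatumOfRecord₁₃C F N D) : D.βfun = betaOfRecord₁₃ F N h.params := by
  have := βfun_datumOfRecord₁₃ F N h.params h.provisos
  rwa [← h.eq_datumOfRecord₁₃] at this

/-- The datum's coupling flow of the run `p` IS the Stage-13 generated history of record of the canonical parameter (def-T's `flow_g_datumOfRecord₁₃`).
[cite: Balaban1987RG1, (0.17)–(0.20) pp.255–256 (bookkeeping)] -/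
theorem IsDatumOfRecord₁₃C.flow_g (h : IsDatumOfRecord₁₃C F N D) (p : B12.RunParams) :
    (D.C p).flow.g = gOfRecord₁₃ F N h.params p := by
  have := flow_g_datumOfRecord₁₃ F N h.params h.provisos p
  rwa [← h.eq_datumOfRecord₁₃] at this

/-- The datum's averaging maps ARE the averaging maps of record. [cite: Balaban1987RG1, (0.4) p.253 (bookkeeping)] -/
theorem IsDatumOfRecord₁₃C.av_eq (h : IsDatumOfRecord₁₃C F N D) : D.av = avOfRecord F N := by
  have := av_datumOfRecord₁₃ F N h.params h.provisos
  rwa [← h.eq_datumOfRecord₁₃] at this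

/-- A Stage-13 datum of record is a datum of record, Stage 0 (binder B1 ∕ node N23's reading). [cite: Balaban1987RG1, (0.3)–(0.4) p.253 (bookkeeping)] -/
theorem IsDatumOfRecord₁₃C.isDatumOfRecord₀ (h : IsDatumOfRecord₁₃C F N D) : IsDatumOfRecord₀ F N D := by
  rw [h.eq_datumOfRecord₁₃]
  exact isDatumOfRecord₀_datumOfRecord₁₃ F N h.params h.provisos

/-- N23 · binder B1 at every Stage-13 datum of record. [cite: Balaban1987RG1, (0.4) p.253] -/
theorem IsDatumOfRecord₁₃C.isPrintedAveraged (h : IsDatumOfRecord₁₃C F N D) : D.IsPrintedAveraged := by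
  rw [h.eq_datumOfRecord₁₃]
  exact isPrintedAveraged_datumOfRecord₁₃ F N h.params h.provisos

/-- **THE ₅C SHADOW AT THE CANONICAL PARAMETER**: a Stage-13 datum of record is refined by a Stage-5 C-bound record at some world (def-T's
`exists_isRecordOfRecord₅C_of_isRecordOfRecord₁₃C` through the world companion) — for consumers keyed at ₅C. [cite: Balaban1989LargeFieldII, Thm 1 + (0.1) pp.355–356 (bookkeeping)] -/
theorem IsDatumOfRecord₁₃C.exists_isRecordOfRecord₅C (h : IsDatumOfRecord₁₃C F N D) :
    ∃ (D₅ : FiniteEpsData F (SU N)) (w : WorldP), IsRecordOfRecord₅C F N D₅ w ∧ D₅.C = D.C ∧ (∀ K g₀ k, D₅.dens K g₀ k = D.dens K g₀ k) ∧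
      D₅.βfun = D.βfun ∧ D₅.av = D.av := by
  obtain ⟨w, hw, -⟩ := h.exists_world_gamma
  obtain ⟨D₅, h₅⟩ := exists_isRecordOfRecord₅C_of_isRecordOfRecord₁₃C hw
  exact ⟨D₅, w, h₅⟩

end DatumKey

/-! ## §2. Canonicalised readings — COHERENCE for records keyed «`∃ θ hP, θ.Admissible F N ∧ D = datumOfRecord₁₃ F N θ hP ∧ S = cr F θ hP …`»

Reading an existentially keyed record through `canon₁₃ f` makes the admitted bundle a function of the DATUM: `canon₁₃ f θ hP = f h.params h.provisos` whenever
`datumOfRecord₁₃ F N θ hP = D` and `h : IsDatumOfRecord₁₃C F N D` (`canon₁₃_eq_of_eq`), so two records keyed independently but read through `canon₁₃` admit, at the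
same `(F, D, g₀, os)`, bundles read at the SAME parameter (`exists_keyed_canon₁₃_iff` turns either key into «`∃ h : IsDatumOfRecord₁₃C F N D, Φ (f h.params
h.provisos)`»).  Off the datum-of-record class `canon₁₃ f = f`. -/
section Canon

variable (F : T4Family) (N : ℕ) [NeZero N] {α : Sort*}

/-- **CANONICALISED READING**: read `f` at the canonical parameter of the datum `datumOfRecord₁₃ F N θ hP` when that datum is of record (admissible), else at
`(θ, hP)` itself.  Kernel bookkeeping (`Classical.dec`, `dite`). [cite: Balaban1989LargeFieldII, Thm 1 + (0.1) pp.355–356 (bookkeeping)] -/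
def canon₁₃ (f : (θ : Stage13Params F N) → θ.Provisos₁₃ F N → α) (θ : Stage13Params F N) (hP : θ.Provisos₁₃ F N) : α := by
  classical
  exact if h : IsDatumOfRecord₁₃C F N (datumOfRecord₁₃ F N θ hP) then f h.params h.provisos else f θ hP

variable {F N}

/-- The canonical parameter depends on the datum only: transport of the key along `D = D'` does not change `.params` (proof irrelevance + `subst`).
[cite: Balaban1989LargeFieldII, Thm 1 + (0.1) pp.355–356 (bookkeeping)] -/
theorem IsDatumOfRecord₁₃C.params_congr {D D' : FiniteEpsData F (SU N)} (h : IsDatumOfRecord₁₃C F N D) (h' : IsDatumOfRecord₁₃C F N D') (e : D = D') :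
    h.params = h'.params := by
  subst e
  rfl

/-- **`canon₁₃ f θ hP = f h.params h.provisos`** whenever `(θ, hP)` realises a datum of record `D` with key `h`. [cite: Balaban1989LargeFieldII, Thm 1 + (0.1) pp.355–356 (bookkeeping)] -/
theorem canon₁₃_eq_of_eq {f : (θ : Stage13Params F N) → θ.Provisos₁₃ F N → α} {D : FiniteEpsData F (SU N)} (h : IsDatumOfRecord₁₃C F N D)
    (θ : Stage13Params F N) (hP : θ.Provisos₁₃ F N) (e : D = datumOfRecord₁₃ F N θ hP) :
    canon₁₃ F N f θ hP = f h.params h.provisos := by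
  subst e
  unfold canon₁₃
  rw [dif_pos h]

/-- At the canonical parameter itself `canon₁₃ f` reads `f`. [cite: Balaban1989LargeFieldII, Thm 1 + (0.1) pp.355–356 (bookkeeping)] -/
theorem canon₁₃_params {f : (θ : Stage13Params F N) → θ.Provisos₁₃ F N → α} {D : FiniteEpsData F (SU N)} (h : IsDatumOfRecord₁₃C F N D) :
    canon₁₃ F N f h.params h.provisos = f h.params h.provisos :=
  canon₁₃_eq_of_eq h h.params h.provisos h.eq_datumOfRecord₁₃

/-- At an admissible tuple with provisos, `canon₁₃ f` reads `f` at the canonical parameter of ITS datum. [cite: Balaban1989LargeFieldII, Thm 1 + (0.1) pp.355–356 (bookkeeping)] -/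
theorem canon₁₃_eq_of_admissible {f : (θ : Stage13Params F N) → θ.Provisos₁₃ F N → α} (θ : Stage13Params F N) (hP : θ.Provisos₁₃ F N) (hθ : θ.Admissible F N) :
    canon₁₃ F N f θ hP = f (isDatumOfRecord₁₃C_datumOfRecord₁₃ F N θ hP hθ).params (isDatumOfRecord₁₃C_datumOfRecord₁₃ F N θ hP hθ).provisos :=
  canon₁₃_eq_of_eq _ θ hP rfl

/-- Off the datum-of-record class nothing is canonicalised. [cite: Balaban1989LargeFieldII, Thm 1 + (0.1) pp.355–356 (bookkeeping)] -/
theorem canon₁₃_eq_self_of_not {f : (θ : Stage13Params F N) → θ.Provisos₁₃ F N → α} (θ : Stage13Params F N) (hP : θ.Provisos₁₃ F N)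
    (hn : ¬ IsDatumOfRecord₁₃C F N (datumOfRecord₁₃ F N θ hP)) : canon₁₃ F N f θ hP = f θ hP := by
  unfold canon₁₃
  rw [dif_neg hn]

/-- **THE KEYED-RECORD FACE**: an existentially keyed record («some admissible `θ` with provisos realises `D` and the bundle reads `canon₁₃ f` there») IS the
datum-keyed record («the bundle reads `f` at the canonical parameter of `D`») — for every property `Φ` of the reading (e.g. `Φ x := S = x g₀ os`).  This is the
sentence that makes (T-SPINE)'s and (T-RATE)'s Stage-13 records COHERENT. [cite: Balaban1989LargeFieldII, Thm 1 + (0.1) pp.355–356 (bookkeeping)] -/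
theorem exists_keyed_canon₁₃_iff {f : (θ : Stage13Params F N) → θ.Provisos₁₃ F N → α} {D : FiniteEpsData F (SU N)} (Φ : α → Prop) :
    (∃ (θ : Stage13Params F N) (hP : θ.Provisos₁₃ F N), θ.Admissible F N ∧ D = datumOfRecord₁₃ F N θ hP ∧ Φ (canon₁₃ F N f θ hP)) ↔
      ∃ h : IsDatumOfRecord₁₃C F N D, Φ (f h.params h.provisos) := by
  constructor
  · rintro ⟨θ, hP, hθ, e, hΦ⟩
    have h : IsDatumOfRecord₁₃C F N D := ⟨θ, hP, hθ, e⟩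
    refine ⟨h, ?_⟩
    rwa [canon₁₃_eq_of_eq (f := f) h θ hP e] at hΦ
  · rintro ⟨h, hΦ⟩
    refine ⟨h.params, h.provisos, h.admissible, h.eq_datumOfRecord₁₃, ?_⟩
    rwa [canon₁₃_params (f := f) h]

/-- **COHERENCE**: two existentially keyed records read through `canon₁₃` admit, at the same datum, readings AT THE SAME PARAMETER.
[cite: Balaban1989LargeFieldII, Thm 1 + (0.1) pp.355–356 (bookkeeping)] -/
theorem keyed_canon₁₃_coherent {β : Sort*} {f : (θ : Stage13Params F N) → θ.Provisos₁₃ F N → α} {g : (θ : Stage13Params F N) → θ.Provisos₁₃ F N → β}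
    {D : FiniteEpsData F (SU N)} (Φ : α → Prop) (Ψ : β → Prop)
    (hΦ : ∃ (θ : Stage13Params F N) (hP : θ.Provisos₁₃ F N), θ.Admissible F N ∧ D = datumOfRecord₁₃ F N θ hP ∧ Φ (canon₁₃ F N f θ hP))
    (hΨ : ∃ (θ : Stage13Params F N) (hP : θ.Provisos₁₃ F N), θ.Admissible F N ∧ D = datumOfRecord₁₃ F N θ hP ∧ Ψ (canon₁₃ F N g θ hP)) :
    ∃ h : IsDatumOfRecord₁₃C F N D, Φ (f h.params h.provisos) ∧ Ψ (g h.params h.provisos) := by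
  obtain ⟨h, h₁⟩ := (exists_keyed_canon₁₃_iff Φ).1 hΦ
  obtain ⟨h', h₂⟩ := (exists_keyed_canon₁₃_iff Ψ).1 hΨ
  exact ⟨h, h₁, h₂⟩

end Canon

/-! ## §3. The θ-exposed Stage-13 record key `IsRateKey₁₃` and the residual ASSIGNMENTS of the rate-record home at Stage 13 (`RateAssignment₁₃` ∕ `SpineAssignment₁₃` over
`Stage13Params`, with the one-token lifts `.ofStage12` ∕ `.ofStage9` of the Stage-12 ∕ Stage-9-typed assignments; RR-1's object containers BY NAME) -/

section Key

variable (F : T4Family) (N : ℕ) [NeZero N]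

/-- **«(D, w) is the Stage-13 record WITH PARAMETERS θ»**: the body of `IsRecordOfRecord₁₃C F N D w` with the Stage-13 parameter tuple EXPOSED — θ is admissible and
satisfies its displayed provisos, its datum of record IS `D`, and the world `w` is bound to the construction with a window `0 < w.γ ≤ θ.γ`, Bałaban's block size and
the C-binding of record over the Stage-13 view. [cite: Balaban1989LargeFieldII, Thm 1 + (0.1) pp.355–356; Balaban1987RG1, (0.24)–(0.25) p.257 (objects of record; bookkeeping)] -/
def IsRateKey₁₃ (D : FiniteEpsData F (SU N)) (w : WorldP) (θ : Stage13Params F N) : Prop :=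
  ∃ h : θ.Provisos₁₃ F N, θ.Admissible F N ∧ D = datumOfRecord₁₃ F N θ h ∧ w.C = D.C ∧ (0 < w.γ ∧ w.γ ≤ θ.γ) ∧
    w.L = (θ.L : ℝ) ∧ ∀ P : B12.RunParams, w.up P = upOfRecord₅C F N (θ.toStage5₁₃ F N) P

/-- **A Stage-13 record IS a keyed record for SOME θ, and conversely** (`Iff.rfl`: the key is `IsRecordOfRecord₁₃C`'s body). [cite: Balaban1989LargeFieldII, Thm 1 + (0.1) pp.355–356 (bookkeeping)] -/
theorem isRecordOfRecord₁₃C_iff_exists_isRateKey₁₃ (D : FiniteEpsData F (SU N)) (w : WorldP) :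
    IsRecordOfRecord₁₃C F N D w ↔ ∃ θ : Stage13Params F N, IsRateKey₁₃ F N D w θ := Iff.rfl

/-- **Pointed form of the key** at the datum of record. [cite: Balaban1989LargeFieldII, Thm 1 + (0.1) pp.355–356 (bookkeeping)] -/
theorem isRateKey₁₃_of_eq (θ : Stage13Params F N) (h : θ.Provisos₁₃ F N) (hθ : θ.Admissible F N) (w : WorldP)
    (hC : w.C = (datumOfRecord₁₃ F N θ h).C) (hγ : 0 < w.γ ∧ w.γ ≤ θ.γ) (hL : w.L = (θ.L : ℝ))
    (hup : ∀ P, w.up P = upOfRecord₅C F N (θ.toStage5₁₃ F N) P) :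
    IsRateKey₁₃ F N (datumOfRecord₁₃ F N θ h) w θ :=
  ⟨h, hθ, rfl, hC, hγ, hL, hup⟩

/-- **Every admissible θ satisfying its provisos is keyed at some world with any window `0 < γw ≤ θ.γ`** — inhabitation of the keyed class is Stage 13's exactly.
[cite: Balaban1989LargeFieldII, Thm 1 + (0.1) pp.355–356 (bookkeeping)] -/
theorem exists_world_isRateKey₁₃ (θ : Stage13Params F N) (h : θ.Provisos₁₃ F N) (hθ : θ.Admissible F N) {γw : ℝ} (hγw : 0 < γw ∧ γw ≤ θ.γ) :
    ∃ w : WorldP, IsRateKey₁₃ F N (datumOfRecord₁₃ F N θ h) w θ ∧ w.γ = γw := by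
  obtain ⟨w₀⟩ := nonempty_worldP
  exact ⟨{ w₀ with
      C := (datumOfRecord₁₃ F N θ h).C, γ := γw, L := (θ.L : ℝ), one_lt_L := by exact_mod_cast θ.hL.2,
      up := fun P => upOfRecord₅C F N (θ.toStage5₁₃ F N) P },
    ⟨h, hθ, rfl, rfl, hγw, rfl, fun _ => rfl⟩, rfl⟩

variable {F N}
variable {D : FiniteEpsData F (SU N)} {w : WorldP} {θ : Stage13Params F N}

/-- A keyed record is a Stage-13 record. [cite: Balaban1989LargeFieldII, Thm 1 + (0.1) pp.355–356 (bookkeeping)] -/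
theorem IsRateKey₁₃.isRecordOfRecord₁₃C (hk : IsRateKey₁₃ F N D w θ) : IsRecordOfRecord₁₃C F N D w := ⟨θ, hk⟩

/-- … hence its datum is a Stage-13 datum of record. [cite: Balaban1989LargeFieldII, Thm 1 p.355 (bookkeeping)] -/
theorem IsRateKey₁₃.isDatumOfRecord₁₃C (hk : IsRateKey₁₃ F N D w θ) : IsDatumOfRecord₁₃C F N D :=
  isDatumOfRecord₁₃C_of_isRecordOfRecord₁₃C hk.isRecordOfRecord₁₃C

/-- The key CERTIFIES θ's provisos and admissibility and realises `D` as θ's datum of record. [cite: Balaban1989LargeFieldI, (0.3)–(0.4) p.176 (bookkeeping)] -/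
theorem IsRateKey₁₃.exists_provisos (hk : IsRateKey₁₃ F N D w θ) : ∃ h : θ.Provisos₁₃ F N, θ.Admissible F N ∧ D = datumOfRecord₁₃ F N θ h := by
  obtain ⟨h, hθ, hD, -⟩ := hk
  exact ⟨h, hθ, hD⟩

/-- The key's θ is admissible. [cite: Balaban1987RG1, (1.20)–(1.21) p.264 (hypothesis dictionary; bookkeeping)] -/
theorem IsRateKey₁₃.admissible (hk : IsRateKey₁₃ F N D w θ) : θ.Admissible F N := by
  obtain ⟨-, hθ, -⟩ := hk
  exact hθ

/-- The world's window is positive. [cite: Balaban1987RG1, Thm 1 p.259 (bookkeeping)] -/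
theorem IsRateKey₁₃.gamma_pos (hk : IsRateKey₁₃ F N D w θ) : 0 < w.γ := by
  obtain ⟨-, -, -, -, hγ, -⟩ := hk
  exact hγ.1

/-- The world's window sits inside θ's coupling window: `w.γ ≤ θ.γ`. [cite: Balaban1987RG1, Thm 1 p.259 (bookkeeping)] -/
theorem IsRateKey₁₃.gamma_le (hk : IsRateKey₁₃ F N D w θ) : w.γ ≤ θ.γ := by
  obtain ⟨-, -, -, -, hγ, -⟩ := hk
  exact hγ.2

/-- The world reads θ's block factor. [cite: Balaban1987RG1, (0.1) p.251 (bookkeeping)] -/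
theorem IsRateKey₁₃.L_eq (hk : IsRateKey₁₃ F N D w θ) : w.L = (θ.L : ℝ) := by
  obtain ⟨-, -, -, -, -, hL, -⟩ := hk
  exact hL

/-- The world is bound to the datum's construction. [cite: Balaban1989LargeFieldII, Thm 1 + (0.1) pp.355–356 (bookkeeping)] -/
theorem IsRateKey₁₃.construction_eq (hk : IsRateKey₁₃ F N D w θ) : w.C = D.C := by
  obtain ⟨-, -, -, hC, -⟩ := hk
  exact hC

/-- The upstream block of the world is the C-binding of record at the Stage-13 view. [cite: Balaban1989LargeFieldII, Thm 1 + (0.1) pp.355–356 (bookkeeping)] -/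
theorem IsRateKey₁₃.up_eq (hk : IsRateKey₁₃ F N D w θ) (P : B12.RunParams) : w.up P = upOfRecord₅C F N (θ.toStage5₁₃ F N) P := by
  obtain ⟨-, -, -, -, -, -, hup⟩ := hk
  exact hup P

end Key

section Assignments

/-- **THE RESIDUAL RATE ASSIGNMENT, STAGE 13**: the rate objects of the construction with family `F`, Stage-13 parameters `θ`, tuned bare sequence `g₀`, loop string
`os` (RR-1's container `RateObjects₁₁`) — an EXPLICIT parameter of the (T-RATE) record at Stage 13, pinned later by name; no law assumed.  A NEW type (the tuple type
changed: `Stage13Params extends Stage12Params` by the (2.9)-species small-field width `ε₂₉`). [cite: Balaban1987RG1, (1.18)–(1.22) pp.263–264 (objects only)] -/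
abbrev RateAssignment₁₃ (N : ℕ) [NeZero N] := (F : T4Family) → Stage13Params F N → (ℕ → ℝ) → List (ULoop F) → RateObjects₁₁ N

/-- **THE RESIDUAL SPINE ASSIGNMENT, STAGE 13**, likewise (RR-1's container `SpineObjects₁₁`), read by the (T-SPINE) record at Stage 13. [cite: Balaban1987RG1, (0.24)–(0.27) pp.257–258 (objects only)] -/
abbrev SpineAssignment₁₃ (N : ℕ) [NeZero N] := (F : T4Family) → Stage13Params F N → (ℕ → ℝ) → List (ULoop F) → SpineObjects₁₁

variable (N : ℕ) [NeZero N]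

/-- A Stage-12 rate assignment (`RateAssignment₁₂`, `Node00/Record12DatumKey`) lifts to Stage 13 by ONE token (`Stage13Params.toStage12Params`).
[cite: Balaban1987RG1, (1.18)–(1.22) pp.263–264 (bookkeeping)] -/
def RateAssignment₁₃.ofStage12 (a : RateAssignment₁₂ N) : RateAssignment₁₃ N :=
  fun F θ g₀ os => a F θ.toStage12Params g₀ os

/-- … and reads, at `θ`, the Stage-12 assignment at `θ.toStage12Params` (`rfl`). [cite: Balaban1987RG1, (1.18)–(1.22) pp.263–264 (bookkeeping)] -/
theorem RateAssignment₁₃.ofStage12_apply (a : RateAssignment₁₂ N) (F : T4Family) (θ : Stage13Params F N) (g₀ : ℕ → ℝ) (os : List (ULoop F)) :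
    RateAssignment₁₃.ofStage12 N a F θ g₀ os = a F θ.toStage12Params g₀ os := rfl

/-- A rate assignment typed over the Stage-9 part lifts to Stage 13. [cite: Balaban1987RG1, (1.18)–(1.22) pp.263–264 (bookkeeping)] -/
def RateAssignment₁₃.ofStage9 (a : (F : T4Family) → Stage9Params F N → (ℕ → ℝ) → List (ULoop F) → RateObjects₁₁ N) : RateAssignment₁₃ N :=
  fun F θ g₀ os => a F θ.toStage9Params g₀ os

/-- … `rfl` face. [cite: Balaban1987RG1, (1.18)–(1.22) pp.263–264 (bookkeeping)] -/
theorem RateAssignment₁₃.ofStage9_apply (a : (F : T4Family) → Stage9Params F N → (ℕ → ℝ) → List (ULoop F) → RateObjects₁₁ N) (F : T4Family)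
    (θ : Stage13Params F N) (g₀ : ℕ → ℝ) (os : List (ULoop F)) : RateAssignment₁₃.ofStage9 N a F θ g₀ os = a F θ.toStage9Params g₀ os := rfl

/-- The two lifts agree: lifting a Stage-9 assignment directly = lifting its Stage-12 lift (`rfl`). [cite: Balaban1987RG1, (1.18)–(1.22) pp.263–264 (bookkeeping)] -/
theorem RateAssignment₁₃.ofStage12_ofStage9 (a : (F : T4Family) → Stage9Params F N → (ℕ → ℝ) → List (ULoop F) → RateObjects₁₁ N) :
    RateAssignment₁₃.ofStage12 N (RateAssignment₁₂.ofStage9 N a) = RateAssignment₁₃.ofStage9 N a := rfl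

/-- A Stage-12 spine assignment lifts to Stage 13 by one token. [cite: Balaban1987RG1, (0.24)–(0.27) pp.257–258 (bookkeeping)] -/
def SpineAssignment₁₃.ofStage12 (s : SpineAssignment₁₂ N) : SpineAssignment₁₃ N :=
  fun F θ g₀ os => s F θ.toStage12Params g₀ os

/-- … `rfl` face. [cite: Balaban1987RG1, (0.24)–(0.27) pp.257–258 (bookkeeping)] -/
theorem SpineAssignment₁₃.ofStage12_apply (s : SpineAssignment₁₂ N) (F : T4Family) (θ : Stage13Params F N) (g₀ : ℕ → ℝ) (os : List (ULoop F)) :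
    SpineAssignment₁₃.ofStage12 N s F θ g₀ os = s F θ.toStage12Params g₀ os := rfl

/-- A spine assignment typed over the Stage-9 part lifts to Stage 13. [cite: Balaban1987RG1, (0.24)–(0.27) pp.257–258 (bookkeeping)] -/
def SpineAssignment₁₃.ofStage9 (s : (F : T4Family) → Stage9Params F N → (ℕ → ℝ) → List (ULoop F) → SpineObjects₁₁) : SpineAssignment₁₃ N :=
  fun F θ g₀ os => s F θ.toStage9Params g₀ os

/-- … `rfl` face. [cite: Balaban1987RG1, (0.24)–(0.27) pp.257–258 (bookkeeping)] -/
theorem SpineAssignment₁₃.ofStage9_apply (s : (F : T4Family) → Stage9Params F N → (ℕ → ℝ) → List (ULoop F) → SpineObjects₁₁) (F : T4Family)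
    (θ : Stage13Params F N) (g₀ : ℕ → ℝ) (os : List (ULoop F)) : SpineAssignment₁₃.ofStage9 N s F θ g₀ os = s F θ.toStage9Params g₀ os := rfl

/-- The two spine lifts agree (`rfl`). [cite: Balaban1987RG1, (0.24)–(0.27) pp.257–258 (bookkeeping)] -/
theorem SpineAssignment₁₃.ofStage12_ofStage9 (s : (F : T4Family) → Stage9Params F N → (ℕ → ℝ) → List (ULoop F) → SpineObjects₁₁) :
    SpineAssignment₁₃.ofStage12 N (SpineAssignment₁₂.ofStage9 N s) = SpineAssignment₁₃.ofStage9 N s := rfl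

/-- Every Stage-13 rate-assignment type is inhabited (the constant assignments at RR-1's trivial objects; class consistency only, NO content).
[cite: Balaban1987RG1, (1.20)–(1.22) p.264 (bookkeeping)] -/
theorem nonempty_rateAssignment₁₃ : Nonempty (RateAssignment₁₃ N) :=
  let ⟨a⟩ := nonempty_rateAssignment₁₂ N
  ⟨RateAssignment₁₃.ofStage12 N a⟩

/-- … with the letter signs satisfiable at every argument. [cite: Balaban1987RG1, (1.20)–(1.22) p.264 (bookkeeping)] -/
theorem exists_rateAssignment₁₃_signs : ∃ a : RateAssignment₁₃ N, ∀ (F : T4Family) (θ : Stage13Params F N) (g₀ : ℕ → ℝ) (os : List (ULoop F)),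
    (a F θ g₀ os).u3.Signs :=
  let ⟨a, ha⟩ := exists_rateAssignment₁₂_signs N
  ⟨RateAssignment₁₃.ofStage12 N a, fun F θ g₀ os => ha F θ.toStage12Params g₀ os⟩

/-- … and the Stage-13 spine assignments. [cite: Balaban1987RG1, (0.24)–(0.27) pp.257–258 (bookkeeping)] -/
theorem nonempty_spineAssignment₁₃ : Nonempty (SpineAssignment₁₃ N) :=
  let ⟨s⟩ := nonempty_spineAssignment₁₂ N
  ⟨SpineAssignment₁₃.ofStage12 N s⟩

end Assignments

/-! ## §4. «`D` is a datum of record, Stage 13, realised IN THE REGIME `Rg`» and its canonical parameter in the regime -/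

section DatumKeyOn

variable (F : T4Family) (N : ℕ) [NeZero N]

/-- **«`D` is a datum of record, Stage 13, realised in the regime `Rg`»**: SOME admissible Stage-13 parameter tuple IN `Rg` satisfying its displayed provisos has `D` as its datum
of record — the common key prefix of the regime-restricted carrier homes (the Stage-13 re-keys of `YMDAG.UVSplit.RRec₁₂On 𝔯 Rg` ∕ `SRec₁₂On cr Rg`).  At `Rg := ⊤` it is the C key (`isDatumOfRecord₁₃COn_true_iff`).
[cite: Balaban1989LargeFieldII, Thm 1 + (0.1) pp.355–356; Balaban1988Convergent, Thms 1–2 pp.262–263 (objects of record; bookkeeping)] -/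
def IsDatumOfRecord₁₃COn (Rg : (F : T4Family) → Stage13Params F N → Prop) (D : FiniteEpsData F (SU N)) : Prop :=
  ∃ (θ : Stage13Params F N) (h : θ.Provisos₁₃ F N), Rg F θ ∧ θ.Admissible F N ∧ D = datumOfRecord₁₃ F N θ h

variable (Rg : (F : T4Family) → Stage13Params F N → Prop)

/-- Unfolding (`Iff.rfl`). [cite: Balaban1989LargeFieldII, Thm 1 + (0.1) pp.355–356 (bookkeeping)] -/
theorem isDatumOfRecord₁₃COn_iff (D : FiniteEpsData F (SU N)) :
    IsDatumOfRecord₁₃COn F N Rg D ↔ ∃ (θ : Stage13Params F N) (h : θ.Provisos₁₃ F N), Rg F θ ∧ θ.Admissible F N ∧ D = datumOfRecord₁₃ F N θ h :=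
  Iff.rfl

/-- Every admissible Stage-13 parameter tuple in the regime with provisos yields a datum of record in the regime. [cite: Balaban1989LargeFieldII, Thm 1 + (0.1) pp.355–356 (bookkeeping)] -/
theorem isDatumOfRecord₁₃COn_datumOfRecord₁₃ (θ : Stage13Params F N) (h : θ.Provisos₁₃ F N) (hRg : Rg F θ) (hθ : θ.Admissible F N) :
    IsDatumOfRecord₁₃COn F N Rg (datumOfRecord₁₃ F N θ h) :=
  ⟨θ, h, hRg, hθ, rfl⟩

/-- **THE HONEST REDUCTION, IN THE REGIME**: some datum of record in `Rg` exists at `(F, N)` iff SOME Stage-13 parameter tuple satisfies every displayed proviso, lies in `Rg` and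
is admissible; inhabitation is NOT claimed in this module. [cite: Balaban1988Convergent, (2.7) p.255, (2.21) p.258, (3.16)–(3.22) pp.268–269; Balaban1987RG1, (1.12)–(1.15) p.262 (hypothesis dictionary; bookkeeping)] -/
theorem exists_isDatumOfRecord₁₃COn_iff_exists_params :
    (∃ D : FiniteEpsData F (SU N), IsDatumOfRecord₁₃COn F N Rg D) ↔ ∃ θ : Stage13Params F N, θ.Provisos₁₃ F N ∧ Rg F θ ∧ θ.Admissible F N := by
  constructor
  · rintro ⟨_, θ, hP, hRg, hθ, -⟩
    exact ⟨θ, hP, hRg, hθ⟩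
  · rintro ⟨θ, hP, hRg, hθ⟩
    exact ⟨_, isDatumOfRecord₁₃COn_datumOfRecord₁₃ F N Rg θ hP hRg hθ⟩

/-- **A PROPERTY OF EVERY DATUM OF RECORD IN THE REGIME ⟺ THE θ-KEYED SENTENCE GUARDED BY `Rg`** (datum level). [cite: Balaban1989LargeFieldII, Thm 1 + (0.1) pp.355–356 (bookkeeping)] -/
theorem forall_isDatumOfRecord₁₃COn_iff (P : FiniteEpsData F (SU N) → Prop) :
    (∀ D : FiniteEpsData F (SU N), IsDatumOfRecord₁₃COn F N Rg D → P D) ↔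
      ∀ (θ : Stage13Params F N) (h : θ.Provisos₁₃ F N), Rg F θ → θ.Admissible F N → P (datumOfRecord₁₃ F N θ h) := by
  constructor
  · intro hall θ h hRg hθ
    exact hall _ (isDatumOfRecord₁₃COn_datumOfRecord₁₃ F N Rg θ h hRg hθ)
  · rintro hall D ⟨θ, h, hRg, hθ, rfl⟩
    exact hall θ h hRg hθ

variable {F N Rg}
variable {D : FiniteEpsData F (SU N)}

/-- The regime forgotten: a datum of record in `Rg` is a datum of record (C key). [cite: Balaban1989LargeFieldII, Thm 1 p.355 (bookkeeping)] -/
theorem IsDatumOfRecord₁₃COn.toC (h : IsDatumOfRecord₁₃COn F N Rg D) : IsDatumOfRecord₁₃C F N D := by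
  obtain ⟨θ, hP, -, hθ, hD⟩ := h
  exact ⟨θ, hP, hθ, hD⟩

/-- Monotone in the regime. [cite: Balaban1989LargeFieldII, Thm 1 p.355 (bookkeeping)] -/
theorem IsDatumOfRecord₁₃COn.mono {Rg' : (F : T4Family) → Stage13Params F N → Prop} (hle : ∀ (F : T4Family) (θ : Stage13Params F N), Rg F θ → Rg' F θ)
    (h : IsDatumOfRecord₁₃COn F N Rg D) : IsDatumOfRecord₁₃COn F N Rg' D := by
  obtain ⟨θ, hP, hRg, hθ, hD⟩ := h
  exact ⟨θ, hP, hle F θ hRg, hθ, hD⟩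

/-- At the trivial regime the key IS the C key. [cite: Balaban1989LargeFieldII, Thm 1 p.355 (bookkeeping)] -/
theorem isDatumOfRecord₁₃COn_true_iff : IsDatumOfRecord₁₃COn F N (fun _ _ => True) D ↔ IsDatumOfRecord₁₃C F N D :=
  ⟨fun h => h.toC, fun ⟨θ, hP, hθ, hD⟩ => ⟨θ, hP, trivial, hθ, hD⟩⟩

/-- A datum of record whose C-CANONICAL parameter lies in the regime is a datum of record in the regime (companion of the (T-RATE) home's `rRec₁₂On_of_regime_params`, re-keyed).
[cite: Balaban1989LargeFieldII, Thm 1 p.355 (bookkeeping)] -/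
theorem IsDatumOfRecord₁₃C.isDatumOfRecord₁₃COn_of_regime_params (h : IsDatumOfRecord₁₃C F N D) (hRg : Rg F h.params) : IsDatumOfRecord₁₃COn F N Rg D :=
  ⟨h.params, h.provisos, hRg, h.admissible, h.eq_datumOfRecord₁₃⟩

/-- **THE CANONICAL STAGE-13 PARAMETER OF A DATUM OF RECORD IN THE REGIME** (choice).  HONEST: it need not equal the C-canonical parameter `h.toC.params` of the same datum
(two choices over two existentials); the regime reaches THIS parameter (`.regime`), never `IsDatumOfRecord₁₃C.params`. [cite: Balaban1989LargeFieldII, Thm 1 + (0.1) pp.355–356 (bookkeeping)] -/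
def IsDatumOfRecord₁₃COn.params (h : IsDatumOfRecord₁₃COn F N Rg D) : Stage13Params F N :=
  Classical.choose h

/-- Its provisos. [cite: Balaban1988Convergent, (2.7) p.255, (2.21) p.258, (2.35) p.261 (bookkeeping)] -/
theorem IsDatumOfRecord₁₃COn.provisos (h : IsDatumOfRecord₁₃COn F N Rg D) : h.params.Provisos₁₃ F N :=
  (Classical.choose_spec h).fst

/-- **It lies IN THE REGIME.** [cite: Balaban1988Convergent, (3.16)–(3.22) pp.268–269 (bookkeeping)] -/
theorem IsDatumOfRecord₁₃COn.regime (h : IsDatumOfRecord₁₃COn F N Rg D) : Rg F h.params :=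
  (Classical.choose_spec h).snd.1

/-- Its admissibility. [cite: Balaban1987RG1, (1.12) p.262; Balaban1988Convergent, (2.10) p.256 (bookkeeping)] -/
theorem IsDatumOfRecord₁₃COn.admissible (h : IsDatumOfRecord₁₃COn F N Rg D) : h.params.Admissible F N :=
  (Classical.choose_spec h).snd.2.1

/-- **The datum IS the datum of record of its canonical parameter in the regime.** [cite: Balaban1989LargeFieldII, Thm 1 p.355 (bookkeeping)] -/
theorem IsDatumOfRecord₁₃COn.eq_datumOfRecord₁₃ (h : IsDatumOfRecord₁₃COn F N Rg D) : D = datumOfRecord₁₃ F N h.params h.provisos :=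
  (Classical.choose_spec h).snd.2.2

/-- The canonical parameter realises a C-datum key of `D` (pointed form; its `.params` is NOT asserted to be `h.params`). [cite: Balaban1989LargeFieldII, Thm 1 p.355 (bookkeeping)] -/
theorem IsDatumOfRecord₁₃COn.isDatumOfRecord₁₃C_params (h : IsDatumOfRecord₁₃COn F N Rg D) :
    IsDatumOfRecord₁₃C F N (datumOfRecord₁₃ F N h.params h.provisos) :=
  isDatumOfRecord₁₃C_datumOfRecord₁₃ F N h.params h.provisos h.admissible

/-- The canonical parameter's coupling window is positive. [cite: Balaban1987RG1, (0.21) p.256 (bookkeeping)] -/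
theorem IsDatumOfRecord₁₃COn.gamma_pos (h : IsDatumOfRecord₁₃COn F N Rg D) : 0 < h.params.γ :=
  h.admissible.toStage9.gamma_pos

/-- … and lies inside `]0, 1[`. [cite: Balaban1988Convergent, (2.28) p.259 (bookkeeping)] -/
theorem IsDatumOfRecord₁₃COn.gamma_lt_one (h : IsDatumOfRecord₁₃COn F N Rg D) : h.params.γ < 1 :=
  h.admissible.toStage12.pos₁₂.2.2.2.2

/-- The canonical parameter in the regime depends on the datum only. [cite: Balaban1989LargeFieldII, Thm 1 + (0.1) pp.355–356 (bookkeeping)] -/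
theorem IsDatumOfRecord₁₃COn.params_congr {D' : FiniteEpsData F (SU N)} (h : IsDatumOfRecord₁₃COn F N Rg D) (h' : IsDatumOfRecord₁₃COn F N Rg D') (e : D = D') :
    h.params = h'.params := by
  subst e
  rfl

/-- **WHAT A CONSUMER PROVES IN THE REGIME ⟹ WHAT THE INSTANCE CARRIES**: a property of the objects of record established at EVERY admissible Stage-13 parameter tuple IN `Rg` with
provisos holds at the canonical parameter in the regime of every datum of record in the regime — the regime is AVAILABLE as a hypothesis. [cite: Balaban1989LargeFieldII, Thm 1 p.355 (bookkeeping)] -/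
theorem IsDatumOfRecord₁₃COn.forall_params {P : (D : FiniteEpsData F (SU N)) → (θ : Stage13Params F N) → θ.Provisos₁₃ F N → Prop}
    (hP : ∀ (θ : Stage13Params F N) (hθ : θ.Provisos₁₃ F N), Rg F θ → θ.Admissible F N → P (datumOfRecord₁₃ F N θ hθ) θ hθ) (h : IsDatumOfRecord₁₃COn F N Rg D) :
    P D h.params h.provisos := by
  have := hP h.params h.provisos h.regime h.admissible
  rwa [← h.eq_datumOfRecord₁₃] at this

/-- The datum's β-functions are the Stage-13 β of record at the canonical parameter. [cite: Balaban1987RG1, (1.20)–(1.22) p.264 (bookkeeping)] -/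
theorem IsDatumOfRecord₁₃COn.βfun_eq_betaOfRecord₁₃ (h : IsDatumOfRecord₁₃COn F N Rg D) : D.βfun = betaOfRecord₁₃ F N h.params := by
  have := βfun_datumOfRecord₁₃ F N h.params h.provisos
  rwa [← h.eq_datumOfRecord₁₃] at this

/-- The datum's coupling flow of the run `p` IS the Stage-13 generated history of record of the canonical parameter. [cite: Balaban1987RG1, (0.17)–(0.20) pp.255–256 (bookkeeping)] -/
theorem IsDatumOfRecord₁₃COn.flow_g (h : IsDatumOfRecord₁₃COn F N Rg D) (p : B12.RunParams) :
    (D.C p).flow.g = gOfRecord₁₃ F N h.params p := by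
  have := flow_g_datumOfRecord₁₃ F N h.params h.provisos p
  rwa [← h.eq_datumOfRecord₁₃] at this

/-- A datum of record in the regime is a datum of record, Stage 0. [cite: Balaban1987RG1, (0.3)–(0.4) p.253 (bookkeeping)] -/
theorem IsDatumOfRecord₁₃COn.isDatumOfRecord₀ (h : IsDatumOfRecord₁₃COn F N Rg D) : IsDatumOfRecord₀ F N D :=
  h.toC.isDatumOfRecord₀


end DatumKeyOn

/-! ## §5. «`(D, w)` is a Stage-13 record realised IN THE REGIME `Rg`»; world companions; the θ-keyed guarded junction -/

section RecordKeyOn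

variable (F : T4Family) (N : ℕ) [NeZero N]

/-- **«`(D, w)` is a Stage-13 record (C-class) realised in the regime `Rg`»**: `IsRecordOfRecord₁₃C F N D w`'s body (the θ-exposed key `IsRateKey₁₃`) with the parameter IN
`Rg` — the regime-restricted record class a guarded composer quantifies over (`Spine`, `S_R00x`, `S_N27x` at `fun F D w => IsRecordOfRecord₁₃COn F N Rg D w`).  At `Rg := ⊤` it is
`IsRecordOfRecord₁₃C` (`isRecordOfRecord₁₃COn_true_iff`). [cite: Balaban1989LargeFieldII, Thm 1 + (0.1) pp.355–356; Balaban1987RG1, (0.24)–(0.25) p.257 (objects of record; bookkeeping)] -/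
def IsRecordOfRecord₁₃COn (Rg : (F : T4Family) → Stage13Params F N → Prop) (D : FiniteEpsData F (SU N)) (w : WorldP) : Prop :=
  ∃ θ : Stage13Params F N, Rg F θ ∧ IsRateKey₁₃ F N D w θ

variable (Rg : (F : T4Family) → Stage13Params F N → Prop)

/-- Unfolding (`Iff.rfl`). [cite: Balaban1989LargeFieldII, Thm 1 + (0.1) pp.355–356 (bookkeeping)] -/
theorem isRecordOfRecord₁₃COn_iff (D : FiniteEpsData F (SU N)) (w : WorldP) :
    IsRecordOfRecord₁₃COn F N Rg D w ↔ ∃ θ : Stage13Params F N, Rg F θ ∧ IsRateKey₁₃ F N D w θ :=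
  Iff.rfl

/-- **Every admissible θ in the regime with provisos is a record in the regime at some world with any window `0 < γw ≤ θ.γ`.** [cite: Balaban1989LargeFieldII, Thm 1 + (0.1) pp.355–356 (bookkeeping)] -/
theorem exists_world_isRecordOfRecord₁₃COn (θ : Stage13Params F N) (h : θ.Provisos₁₃ F N) (hRg : Rg F θ) (hθ : θ.Admissible F N) {γw : ℝ}
    (hγw : 0 < γw ∧ γw ≤ θ.γ) : ∃ w : WorldP, IsRecordOfRecord₁₃COn F N Rg (datumOfRecord₁₃ F N θ h) w ∧ w.γ = γw := by
  obtain ⟨w, hk, hγ⟩ := exists_world_isRateKey₁₃ F N θ h hθ hγw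
  exact ⟨w, ⟨θ, hRg, hk⟩, hγ⟩

/-- Some datum of record in the regime exists iff some record in the regime exists. [cite: Balaban1989LargeFieldII, Thm 1 + (0.1) pp.355–356 (bookkeeping)] -/
theorem exists_isDatumOfRecord₁₃COn_iff_exists_record :
    (∃ D : FiniteEpsData F (SU N), IsDatumOfRecord₁₃COn F N Rg D) ↔ ∃ (D : FiniteEpsData F (SU N)) (w : WorldP), IsRecordOfRecord₁₃COn F N Rg D w := by
  constructor
  · rintro ⟨_, θ, hP, hRg, hθ, rfl⟩
    obtain ⟨w, hw, -⟩ := exists_world_isRecordOfRecord₁₃COn F N Rg θ hP hRg hθ ⟨hθ.toStage9.gamma_pos, le_rfl⟩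
    exact ⟨_, w, hw⟩
  · rintro ⟨D, w, θ, hRg, hk⟩
    obtain ⟨hP, hθ, hD⟩ := hk.exists_provisos
    exact ⟨D, θ, hP, hRg, hθ, hD⟩

/-- **A WORLD-BLIND PROPERTY AT EVERY RECORD IN THE REGIME ⟺ THE θ-KEYED SENTENCE GUARDED BY `Rg`** — the junction between a composer's conclusion over the regime-restricted
record class (e.g. `YMDAG.UVSplit.Spine` at `IsRecordOfRecord₁₃COn F N Rg`) and an item text «`∀ θ (h : θ.Provisos₁₃ F N), Rg F θ → θ.Admissible F N → P (datumOfRecord₁₃ F N θ h)`».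
[cite: Balaban1989LargeFieldII, Thm 1 + (0.1) pp.355–356 (bookkeeping)] -/
theorem forall_isRecordOfRecord₁₃COn_iff (P : FiniteEpsData F (SU N) → Prop) :
    (∀ (D : FiniteEpsData F (SU N)) (w : WorldP), IsRecordOfRecord₁₃COn F N Rg D w → P D) ↔
      ∀ (θ : Stage13Params F N) (h : θ.Provisos₁₃ F N), Rg F θ → θ.Admissible F N → P (datumOfRecord₁₃ F N θ h) := by
  constructor
  · intro hall θ h hRg hθ
    obtain ⟨w, hw, -⟩ := exists_world_isRecordOfRecord₁₃COn F N Rg θ h hRg hθ ⟨hθ.toStage9.gamma_pos, le_rfl⟩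
    exact hall _ w hw
  · rintro hall D w ⟨θ, hRg, hk⟩
    obtain ⟨h, hθ, rfl⟩ := hk.exists_provisos
    exact hall θ h hRg hθ

variable {F N Rg}
variable {D : FiniteEpsData F (SU N)} {w : WorldP}

/-- The regime forgotten: a record in the regime is a Stage-13 record. [cite: Balaban1989LargeFieldII, Thm 1 p.355 (bookkeeping)] -/
theorem IsRecordOfRecord₁₃COn.isRecordOfRecord₁₃C (h : IsRecordOfRecord₁₃COn F N Rg D w) : IsRecordOfRecord₁₃C F N D w := by
  obtain ⟨θ, -, hk⟩ := h
  exact hk.isRecordOfRecord₁₃C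

/-- Its datum is a datum of record in the regime. [cite: Balaban1989LargeFieldII, Thm 1 p.355 (bookkeeping)] -/
theorem IsRecordOfRecord₁₃COn.isDatumOfRecord₁₃COn (h : IsRecordOfRecord₁₃COn F N Rg D w) : IsDatumOfRecord₁₃COn F N Rg D := by
  obtain ⟨θ, hRg, hk⟩ := h
  obtain ⟨hP, hθ, hD⟩ := hk.exists_provisos
  exact ⟨θ, hP, hRg, hθ, hD⟩

/-- **THE TUPLE IN THE REGIME BEHIND A RECORD IN THE REGIME** — exactly the hypothesis shape of the (T-RATE) home's `s_R00x_rRec₁₂On_of_regime` (to be re-keyed at ₁₃) («every record of `Rec` comes with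
an admissible tuple with provisos in the regime realising `D`»): ONE application. [cite: Balaban1989LargeFieldII, Thm 1 + (0.1) pp.355–356 (bookkeeping)] -/
theorem IsRecordOfRecord₁₃COn.exists_regime_tuple (h : IsRecordOfRecord₁₃COn F N Rg D w) :
    ∃ (θ : Stage13Params F N) (hP : θ.Provisos₁₃ F N), Rg F θ ∧ θ.Admissible F N ∧ D = datumOfRecord₁₃ F N θ hP :=
  h.isDatumOfRecord₁₃COn

/-- Monotone in the regime. [cite: Balaban1989LargeFieldII, Thm 1 p.355 (bookkeeping)] -/
theorem IsRecordOfRecord₁₃COn.mono {Rg' : (F : T4Family) → Stage13Params F N → Prop} (hle : ∀ (F : T4Family) (θ : Stage13Params F N), Rg F θ → Rg' F θ)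
    (h : IsRecordOfRecord₁₃COn F N Rg D w) : IsRecordOfRecord₁₃COn F N Rg' D w := by
  obtain ⟨θ, hRg, hk⟩ := h
  exact ⟨θ, hle F θ hRg, hk⟩

/-- The world's window is positive. [cite: Balaban1987RG1, Thm 1 p.259 (bookkeeping)] -/
theorem IsRecordOfRecord₁₃COn.gamma_pos (h : IsRecordOfRecord₁₃COn F N Rg D w) : 0 < w.γ := by
  obtain ⟨θ, -, hk⟩ := h
  exact hk.gamma_pos

/-- The world is bound to the datum's construction. [cite: Balaban1989LargeFieldII, Thm 1 + (0.1) pp.355–356 (bookkeeping)] -/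
theorem IsRecordOfRecord₁₃COn.construction_eq (h : IsRecordOfRecord₁₃COn F N Rg D w) : w.C = D.C := by
  obtain ⟨θ, -, hk⟩ := h
  exact hk.construction_eq

/-- A Stage-13 record keyed at a θ IN THE REGIME is a record in the regime (pointed intro). [cite: Balaban1989LargeFieldII, Thm 1 + (0.1) pp.355–356 (bookkeeping)] -/
theorem IsRateKey₁₃.isRecordOfRecord₁₃COn {θ : Stage13Params F N} (hk : IsRateKey₁₃ F N D w θ) (hRg : Rg F θ) : IsRecordOfRecord₁₃COn F N Rg D w :=
  ⟨θ, hRg, hk⟩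

/-- At the trivial regime the record key IS `IsRecordOfRecord₁₃C`. [cite: Balaban1989LargeFieldII, Thm 1 p.355 (bookkeeping)] -/
theorem isRecordOfRecord₁₃COn_true_iff : IsRecordOfRecord₁₃COn F N (fun _ _ => True) D w ↔ IsRecordOfRecord₁₃C F N D w :=
  ⟨fun h => h.isRecordOfRecord₁₃C, fun ⟨θ, hk⟩ => ⟨θ, trivial, hk⟩⟩

/-- **DATUM OF RECORD IN THE REGIME ⟺ RECORD IN THE REGIME AT SOME WORLD.** [cite: Balaban1989LargeFieldII, Thm 1 + (0.1) pp.355–356 (bookkeeping)] -/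
theorem isDatumOfRecord₁₃COn_iff_exists_world : IsDatumOfRecord₁₃COn F N Rg D ↔ ∃ w : WorldP, IsRecordOfRecord₁₃COn F N Rg D w := by
  constructor
  · rintro ⟨θ, hP, hRg, hθ, rfl⟩
    obtain ⟨w, hw, -⟩ := exists_world_isRecordOfRecord₁₃COn F N Rg θ hP hRg hθ ⟨hθ.toStage9.gamma_pos, le_rfl⟩
    exact ⟨w, hw⟩
  · rintro ⟨w, hw⟩
    exact hw.isDatumOfRecord₁₃COn

/-- **WORLD COMPANION IN THE REGIME AT ANY WINDOW BELOW THE CANONICAL ONE** (what an N17-type home-keying binder consumes once the U3 radius is pinned in `]0, h.params.γ]`).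
[cite: Balaban1989LargeFieldII, Thm 1 + (0.1) pp.355–356 (bookkeeping)] -/
theorem IsDatumOfRecord₁₃COn.exists_world (h : IsDatumOfRecord₁₃COn F N Rg D) {γw : ℝ} (hγw : 0 < γw ∧ γw ≤ h.params.γ) :
    ∃ w : WorldP, IsRecordOfRecord₁₃COn F N Rg D w ∧ w.γ = γw := by
  obtain ⟨w, hw, hγ⟩ := exists_world_isRecordOfRecord₁₃COn F N Rg h.params h.provisos h.regime h.admissible hγw
  exact ⟨w, h.eq_datumOfRecord₁₃ ▸ hw, hγ⟩

/-- … in particular at the canonical window itself. [cite: Balaban1989LargeFieldII, Thm 1 + (0.1) pp.355–356 (bookkeeping)] -/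
theorem IsDatumOfRecord₁₃COn.exists_world_gamma (h : IsDatumOfRecord₁₃COn F N Rg D) :
    ∃ w : WorldP, IsRecordOfRecord₁₃COn F N Rg D w ∧ w.γ = h.params.γ :=
  h.exists_world ⟨h.gamma_pos, le_rfl⟩

/-- The ₅C shadow at the canonical parameter in the regime (for consumers keyed at ₅C). [cite: Balaban1989LargeFieldII, Thm 1 + (0.1) pp.355–356 (bookkeeping)] -/
theorem IsDatumOfRecord₁₃COn.exists_isRecordOfRecord₅C (h : IsDatumOfRecord₁₃COn F N Rg D) :
    ∃ (D₅ : FiniteEpsData F (SU N)) (w : WorldP), IsRecordOfRecord₅C F N D₅ w ∧ D₅.C = D.C ∧ (∀ K g₀ k, D₅.dens K g₀ k = D.dens K g₀ k) ∧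
      D₅.βfun = D.βfun ∧ D₅.av = D.av :=
  h.toC.exists_isRecordOfRecord₅C

end RecordKeyOn

/-! ## §6. Canonicalised readings RELATIVE TO THE REGIME — coherence for regime homes keyed «`∃ θ hP, Rg F θ ∧ θ.Admissible F N ∧ D = datumOfRecord₁₃ F N θ hP ∧ S = cr F θ hP …`»

As `canon₁₃` (gen 2) for the C key: reading a regime-keyed record through `canon₁₃On Rg f` makes the admitted bundle a function of the DATUM, read at the canonical parameter IN
THE REGIME, so two regime homes read through `canon₁₃On Rg` admit, at the same `(F, D, g₀, os)`, bundles read at ONE parameter (`exists_keyed_canon₁₃On_iff`,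
`keyed_canon₁₃On_coherent`).  Off the class `canon₁₃On Rg f = f`. -/
section CanonOn

variable (F : T4Family) (N : ℕ) [NeZero N] (Rg : (F : T4Family) → Stage13Params F N → Prop) {α : Sort*}

/-- **CANONICALISED READING RELATIVE TO THE REGIME**: read `f` at the canonical parameter in `Rg` of the datum `datumOfRecord₁₃ F N θ hP` when that datum is of record in the
regime, else at `(θ, hP)` itself.  Kernel bookkeeping (`Classical.dec`, `dite`). [cite: Balaban1989LargeFieldII, Thm 1 + (0.1) pp.355–356 (bookkeeping)] -/
def canon₁₃On (f : (θ : Stage13Params F N) → θ.Provisos₁₃ F N → α) (θ : Stage13Params F N) (hP : θ.Provisos₁₃ F N) : α := by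
  classical
  exact if h : IsDatumOfRecord₁₃COn F N Rg (datumOfRecord₁₃ F N θ hP) then f h.params h.provisos else f θ hP

variable {F N Rg}

/-- **`canon₁₃On Rg f θ hP = f h.params h.provisos`** whenever `(θ, hP)` realises a datum of record in the regime `D` with key `h`. [cite: Balaban1989LargeFieldII, Thm 1 + (0.1) pp.355–356 (bookkeeping)] -/
theorem canon₁₃On_eq_of_eq {f : (θ : Stage13Params F N) → θ.Provisos₁₃ F N → α} {D : FiniteEpsData F (SU N)} (h : IsDatumOfRecord₁₃COn F N Rg D)
    (θ : Stage13Params F N) (hP : θ.Provisos₁₃ F N) (e : D = datumOfRecord₁₃ F N θ hP) :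
    canon₁₃On F N Rg f θ hP = f h.params h.provisos := by
  subst e
  unfold canon₁₃On
  rw [dif_pos h]

/-- At the canonical parameter in the regime `canon₁₃On Rg f` reads `f`. [cite: Balaban1989LargeFieldII, Thm 1 + (0.1) pp.355–356 (bookkeeping)] -/
theorem canon₁₃On_params {f : (θ : Stage13Params F N) → θ.Provisos₁₃ F N → α} {D : FiniteEpsData F (SU N)} (h : IsDatumOfRecord₁₃COn F N Rg D) :
    canon₁₃On F N Rg f h.params h.provisos = f h.params h.provisos :=
  canon₁₃On_eq_of_eq h h.params h.provisos h.eq_datumOfRecord₁₃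

/-- At an admissible tuple IN THE REGIME with provisos, `canon₁₃On Rg f` reads `f` at the canonical parameter in the regime of ITS datum. [cite: Balaban1989LargeFieldII, Thm 1 + (0.1) pp.355–356 (bookkeeping)] -/
theorem canon₁₃On_eq_of_regime {f : (θ : Stage13Params F N) → θ.Provisos₁₃ F N → α} (θ : Stage13Params F N) (hP : θ.Provisos₁₃ F N) (hRg : Rg F θ)
    (hθ : θ.Admissible F N) :
    canon₁₃On F N Rg f θ hP = f (isDatumOfRecord₁₃COn_datumOfRecord₁₃ F N Rg θ hP hRg hθ).params (isDatumOfRecord₁₃COn_datumOfRecord₁₃ F N Rg θ hP hRg hθ).provisos :=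
  canon₁₃On_eq_of_eq _ θ hP rfl

/-- Off the class nothing is canonicalised. [cite: Balaban1989LargeFieldII, Thm 1 + (0.1) pp.355–356 (bookkeeping)] -/
theorem canon₁₃On_eq_self_of_not {f : (θ : Stage13Params F N) → θ.Provisos₁₃ F N → α} (θ : Stage13Params F N) (hP : θ.Provisos₁₃ F N)
    (hn : ¬ IsDatumOfRecord₁₃COn F N Rg (datumOfRecord₁₃ F N θ hP)) : canon₁₃On F N Rg f θ hP = f θ hP := by
  unfold canon₁₃On
  rw [dif_neg hn]

/-- **THE KEYED-RECORD FACE, IN THE REGIME**: a regime-keyed record read through `canon₁₃On Rg f` IS the datum-keyed record «the bundle reads `f` at the canonical parameter in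
the regime of `D`», for every property `Φ` of the reading. [cite: Balaban1989LargeFieldII, Thm 1 + (0.1) pp.355–356 (bookkeeping)] -/
theorem exists_keyed_canon₁₃On_iff {f : (θ : Stage13Params F N) → θ.Provisos₁₃ F N → α} {D : FiniteEpsData F (SU N)} (Φ : α → Prop) :
    (∃ (θ : Stage13Params F N) (hP : θ.Provisos₁₃ F N), Rg F θ ∧ θ.Admissible F N ∧ D = datumOfRecord₁₃ F N θ hP ∧ Φ (canon₁₃On F N Rg f θ hP)) ↔
      ∃ h : IsDatumOfRecord₁₃COn F N Rg D, Φ (f h.params h.provisos) := by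
  constructor
  · rintro ⟨θ, hP, hRg, hθ, e, hΦ⟩
    have h : IsDatumOfRecord₁₃COn F N Rg D := ⟨θ, hP, hRg, hθ, e⟩
    refine ⟨h, ?_⟩
    rwa [canon₁₃On_eq_of_eq (f := f) h θ hP e] at hΦ
  · rintro ⟨h, hΦ⟩
    refine ⟨h.params, h.provisos, h.regime, h.admissible, h.eq_datumOfRecord₁₃, ?_⟩
    rwa [canon₁₃On_params (f := f) h]

/-- **COHERENCE IN THE REGIME**: two regime-keyed records read through `canon₁₃On Rg` admit, at the same datum, readings AT THE SAME PARAMETER.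
[cite: Balaban1989LargeFieldII, Thm 1 + (0.1) pp.355–356 (bookkeeping)] -/
theorem keyed_canon₁₃On_coherent {β : Sort*} {f : (θ : Stage13Params F N) → θ.Provisos₁₃ F N → α} {g : (θ : Stage13Params F N) → θ.Provisos₁₃ F N → β}
    {D : FiniteEpsData F (SU N)} (Φ : α → Prop) (Ψ : β → Prop)
    (hΦ : ∃ (θ : Stage13Params F N) (hP : θ.Provisos₁₃ F N), Rg F θ ∧ θ.Admissible F N ∧ D = datumOfRecord₁₃ F N θ hP ∧ Φ (canon₁₃On F N Rg f θ hP))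
    (hΨ : ∃ (θ : Stage13Params F N) (hP : θ.Provisos₁₃ F N), Rg F θ ∧ θ.Admissible F N ∧ D = datumOfRecord₁₃ F N θ hP ∧ Ψ (canon₁₃On F N Rg g θ hP)) :
    ∃ h : IsDatumOfRecord₁₃COn F N Rg D, Φ (f h.params h.provisos) ∧ Ψ (g h.params h.provisos) := by
  obtain ⟨h, h₁⟩ := (exists_keyed_canon₁₃On_iff Φ).1 hΦ
  obtain ⟨h', h₂⟩ := (exists_keyed_canon₁₃On_iff Ψ).1 hΨ
  exact ⟨h, h₁, h₂⟩

end CanonOn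

/-! ## §7. THE GUARD OF RECORD «partition of unity ∧ non-degenerate present slots» and the CN instances

The route's Stage-13 items (rev 16, to be minted) bundle `θ.ZtUnity F N` (print's partition of unity for the residual 𝐓-weights, [Balaban1988Convergent] (3.16)–(3.20)) and
`θ.SlotsNondegenerate₁₃ F N` (no present slot of record is the zero density, (3.22)) into ONE conjunction on the datum's own parameter.  Named once as a regime; the «CN key» is
§4–§6 at that regime. -/

section Guard

variable (F : T4Family) (N : ℕ) [NeZero N]

/-- **THE GUARD OF RECORD, as a regime**: `θ.ZtUnity F N ∧ θ.SlotsNondegenerate₁₃ F N` — print's partition of unity for the residual 𝐓-weights AND non-degeneracy of the present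
slots, ONE bundled conjunction on the same `θ` (director-ym LINE №112; NOT a proviso: hypotheses a consumer takes and destructures).
[cite: Balaban1988Convergent, (3.16)–(3.20) pp.268–269, (3.22) p.269] -/
abbrev unityNondeg₁₃ : (F : T4Family) → Stage13Params F N → Prop :=
  fun F θ => θ.ZtUnity F N ∧ θ.SlotsNondegenerate₁₃ F N

/-- Unfolding (`Iff.rfl`). [cite: Balaban1988Convergent, (3.16)–(3.22) pp.268–269 (bookkeeping)] -/
theorem unityNondeg₁₃_iff (θ : Stage13Params F N) : unityNondeg₁₃ N F θ ↔ θ.ZtUnity F N ∧ θ.SlotsNondegenerate₁₃ F N :=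
  Iff.rfl

/-- **THE CN KEY — «`D` is a datum of record, Stage 13, realised by an admissible tuple WITH print's partition of unity AND non-degenerate present slots»**: the datum key
at the guard of record. [cite: Balaban1989LargeFieldII, Thm 1 + (0.1) pp.355–356; Balaban1988Convergent, (3.16)–(3.22) pp.268–269 (objects of record; bookkeeping)] -/
abbrev IsDatumOfRecord₁₃CN (D : FiniteEpsData F (SU N)) : Prop :=
  IsDatumOfRecord₁₃COn F N (unityNondeg₁₃ N) D

/-- **THE CN RECORD CLASS** at the guard of record. [cite: Balaban1989LargeFieldII, Thm 1 + (0.1) pp.355–356; Balaban1988Convergent, (3.16)–(3.22) pp.268–269 (objects of record; bookkeeping)] -/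
abbrev IsRecordOfRecord₁₃CN (D : FiniteEpsData F (SU N)) (w : WorldP) : Prop :=
  IsRecordOfRecord₁₃COn F N (unityNondeg₁₃ N) D w

/-- **The CN key, literally**: SOME Stage-13 parameter tuple with provisos, `(θ.ZtUnity F N ∧ θ.SlotsNondegenerate₁₃ F N)`, admissible, has `D` as its datum of record (`Iff.rfl`).
[cite: Balaban1989LargeFieldII, Thm 1 + (0.1) pp.355–356; Balaban1988Convergent, (3.16)–(3.22) pp.268–269 (bookkeeping)] -/
theorem isDatumOfRecord₁₃CN_iff (D : FiniteEpsData F (SU N)) :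
    IsDatumOfRecord₁₃CN F N D ↔
      ∃ (θ : Stage13Params F N) (h : θ.Provisos₁₃ F N), (θ.ZtUnity F N ∧ θ.SlotsNondegenerate₁₃ F N) ∧ θ.Admissible F N ∧ D = datumOfRecord₁₃ F N θ h :=
  Iff.rfl

/-- **The CN record class, literally** (`Iff.rfl`). [cite: Balaban1989LargeFieldII, Thm 1 + (0.1) pp.355–356 (bookkeeping)] -/
theorem isRecordOfRecord₁₃CN_iff (D : FiniteEpsData F (SU N)) (w : WorldP) :
    IsRecordOfRecord₁₃CN F N D w ↔ ∃ θ : Stage13Params F N, (θ.ZtUnity F N ∧ θ.SlotsNondegenerate₁₃ F N) ∧ IsRateKey₁₃ F N D w θ :=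
  Iff.rfl

/-- Intro at a guarded admissible tuple with provisos. [cite: Balaban1989LargeFieldII, Thm 1 + (0.1) pp.355–356 (bookkeeping)] -/
theorem isDatumOfRecord₁₃CN_datumOfRecord₁₃ (θ : Stage13Params F N) (h : θ.Provisos₁₃ F N) (hG : θ.ZtUnity F N ∧ θ.SlotsNondegenerate₁₃ F N) (hθ : θ.Admissible F N) :
    IsDatumOfRecord₁₃CN F N (datumOfRecord₁₃ F N θ h) :=
  isDatumOfRecord₁₃COn_datumOfRecord₁₃ F N _ θ h hG hθ

/-- **K0′ READS THE SAME AT THE CN DATUM**: some CN datum of record exists at `(F, N)` iff SOME Stage-13 parameter tuple satisfies every displayed proviso, print's partition of unity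
and non-degeneracy of the present slots, and is admissible — the body of the route's `Record12Inhabited` (rev 15) at `(F, N)`, verbatim; inhabitation is NOT claimed here.
[cite: Balaban1988Convergent, (2.7) p.255, (2.21) p.258, (2.28) p.259, (3.16)–(3.22) pp.268–269; Balaban1987RG1, (1.12)–(1.15) p.262 (hypothesis dictionary; bookkeeping)] -/
theorem exists_isDatumOfRecord₁₃CN_iff_exists_params :
    (∃ D : FiniteEpsData F (SU N), IsDatumOfRecord₁₃CN F N D) ↔
      ∃ θ : Stage13Params F N, θ.Provisos₁₃ F N ∧ (θ.ZtUnity F N ∧ θ.SlotsNondegenerate₁₃ F N) ∧ θ.Admissible F N :=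
  exists_isDatumOfRecord₁₃COn_iff_exists_params F N _

/-- … and iff some CN record exists. [cite: Balaban1989LargeFieldII, Thm 1 + (0.1) pp.355–356 (bookkeeping)] -/
theorem exists_isRecordOfRecord₁₃CN_iff_exists_params :
    (∃ (D : FiniteEpsData F (SU N)) (w : WorldP), IsRecordOfRecord₁₃CN F N D w) ↔
      ∃ θ : Stage13Params F N, θ.Provisos₁₃ F N ∧ (θ.ZtUnity F N ∧ θ.SlotsNondegenerate₁₃ F N) ∧ θ.Admissible F N :=
  (exists_isDatumOfRecord₁₃COn_iff_exists_record F N _).symm.trans (exists_isDatumOfRecord₁₃CN_iff_exists_params F N)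

/-- **THE K2′ ∕ K3′ JUNCTION**: a world-blind property at EVERY CN record ⟺ the θ-keyed sentence «`∀ θ (h : θ.Provisos₁₃ F N), (θ.ZtUnity F N ∧ θ.SlotsNondegenerate₁₃ F N) →
θ.Admissible F N → P (datumOfRecord₁₃ F N θ h)`» — the items' binder prefix (what a `Spine` ∕ endpoint composer over the CN record class reads the text off).
[cite: Balaban1989LargeFieldII, Thm 1 + (0.1) pp.355–356 (bookkeeping)] -/
theorem forall_isRecordOfRecord₁₃CN_iff (P : FiniteEpsData F (SU N) → Prop) :
    (∀ (D : FiniteEpsData F (SU N)) (w : WorldP), IsRecordOfRecord₁₃CN F N D w → P D) ↔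
      ∀ (θ : Stage13Params F N) (h : θ.Provisos₁₃ F N), (θ.ZtUnity F N ∧ θ.SlotsNondegenerate₁₃ F N) → θ.Admissible F N → P (datumOfRecord₁₃ F N θ h) :=
  forall_isRecordOfRecord₁₃COn_iff F N _ P

/-- … datum-level form. [cite: Balaban1989LargeFieldII, Thm 1 + (0.1) pp.355–356 (bookkeeping)] -/
theorem forall_isDatumOfRecord₁₃CN_iff (P : FiniteEpsData F (SU N) → Prop) :
    (∀ D : FiniteEpsData F (SU N), IsDatumOfRecord₁₃CN F N D → P D) ↔
      ∀ (θ : Stage13Params F N) (h : θ.Provisos₁₃ F N), (θ.ZtUnity F N ∧ θ.SlotsNondegenerate₁₃ F N) → θ.Admissible F N → P (datumOfRecord₁₃ F N θ h) :=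
  forall_isDatumOfRecord₁₃COn_iff F N _ P

/-- Every guarded admissible θ with provisos is a CN record at some world with any window `0 < γw ≤ θ.γ`. [cite: Balaban1989LargeFieldII, Thm 1 + (0.1) pp.355–356 (bookkeeping)] -/
theorem exists_world_isRecordOfRecord₁₃CN (θ : Stage13Params F N) (h : θ.Provisos₁₃ F N) (hG : θ.ZtUnity F N ∧ θ.SlotsNondegenerate₁₃ F N) (hθ : θ.Admissible F N)
    {γw : ℝ} (hγw : 0 < γw ∧ γw ≤ θ.γ) : ∃ w : WorldP, IsRecordOfRecord₁₃CN F N (datumOfRecord₁₃ F N θ h) w ∧ w.γ = γw :=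
  exists_world_isRecordOfRecord₁₃COn F N _ θ h hG hθ hγw

variable {F N}
variable {D : FiniteEpsData F (SU N)} {w : WorldP}

/-- **THE GUARD AT THE CANONICAL CN PARAMETER** — the one thing the C key cannot supply. [cite: Balaban1988Convergent, (3.16)–(3.22) pp.268–269 (bookkeeping)] -/
theorem IsDatumOfRecord₁₃CN.guard (h : IsDatumOfRecord₁₃CN F N D) : h.params.ZtUnity F N ∧ h.params.SlotsNondegenerate₁₃ F N :=
  h.regime

/-- Print's partition of unity at the canonical CN parameter. [cite: Balaban1988Convergent, (3.16)–(3.20) pp.268–269 (bookkeeping)] -/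
theorem IsDatumOfRecord₁₃CN.ztUnity (h : IsDatumOfRecord₁₃CN F N D) : h.params.ZtUnity F N :=
  h.regime.1

/-- Non-degeneracy of the present slots at the canonical CN parameter. [cite: Balaban1988Convergent, (3.22) p.269 (bookkeeping)] -/
theorem IsDatumOfRecord₁₃CN.slotsNondegenerate (h : IsDatumOfRecord₁₃CN F N D) : h.params.SlotsNondegenerate₁₃ F N :=
  h.regime.2

/-- **WHAT A CONSUMER PROVES UNDER THE GUARD ⟹ WHAT THE CN INSTANCE CARRIES** (the items' binder order: guard, then admissibility). [cite: Balaban1989LargeFieldII, Thm 1 p.355 (bookkeeping)] -/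
theorem IsDatumOfRecord₁₃CN.forall_params {P : (D : FiniteEpsData F (SU N)) → (θ : Stage13Params F N) → θ.Provisos₁₃ F N → Prop}
    (hP : ∀ (θ : Stage13Params F N) (hθ : θ.Provisos₁₃ F N), (θ.ZtUnity F N ∧ θ.SlotsNondegenerate₁₃ F N) → θ.Admissible F N → P (datumOfRecord₁₃ F N θ hθ) θ hθ)
    (h : IsDatumOfRecord₁₃CN F N D) : P D h.params h.provisos :=
  IsDatumOfRecord₁₃COn.forall_params hP h

/-- A CN datum is a C datum (the guard forgotten; its C-canonical parameter is NOT asserted to satisfy the guard). [cite: Balaban1989LargeFieldII, Thm 1 p.355 (bookkeeping)] -/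
theorem IsDatumOfRecord₁₃CN.isDatumOfRecord₁₃C (h : IsDatumOfRecord₁₃CN F N D) : IsDatumOfRecord₁₃C F N D :=
  h.toC

/-- A CN record is a Stage-13 record. [cite: Balaban1989LargeFieldII, Thm 1 p.355 (bookkeeping)] -/
theorem IsRecordOfRecord₁₃CN.isRecordOfRecord₁₃C' (h : IsRecordOfRecord₁₃CN F N D w) : IsRecordOfRecord₁₃C F N D w :=
  h.isRecordOfRecord₁₃C

/-- The guarded tuple behind a CN record (feeds the ₁₃ re-key of `s_R00x_rRec₁₂On_of_regime 𝔯 ·` at `unityNondeg₁₃ N` in one application). [cite: Balaban1989LargeFieldII, Thm 1 + (0.1) pp.355–356 (bookkeeping)] -/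
theorem IsRecordOfRecord₁₃CN.exists_guarded_tuple (h : IsRecordOfRecord₁₃CN F N D w) :
    ∃ (θ : Stage13Params F N) (hP : θ.Provisos₁₃ F N), (θ.ZtUnity F N ∧ θ.SlotsNondegenerate₁₃ F N) ∧ θ.Admissible F N ∧ D = datumOfRecord₁₃ F N θ hP :=
  h.exists_regime_tuple

/-- A datum of record whose C-canonical parameter satisfies the guard is a CN datum. [cite: Balaban1989LargeFieldII, Thm 1 p.355 (bookkeeping)] -/
theorem IsDatumOfRecord₁₃C.isDatumOfRecord₁₃CN_of_guard (h : IsDatumOfRecord₁₃C F N D) (hG : h.params.ZtUnity F N ∧ h.params.SlotsNondegenerate₁₃ F N) :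
    IsDatumOfRecord₁₃CN F N D :=
  h.isDatumOfRecord₁₃COn_of_regime_params hG

end Guard

end Literature.MathematicalPhysics.QuantumFieldTheory.Balaban1983to89.Node00

end
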